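import Literature.NumberTheory.GaloisRepresentations.ContinuousH2
import Literature.NumberTheory.GaloisRepresentations.DiscreteCochains
import HarnessLib

/-!
# Connecting homomorphisms `H⁰ → H¹ → H²` for short exact sequences of discrete modules

For a topological group `Γ` (locally compact, e.g. profinite) and a short exact sequence
`0 → M₁ →(f) M₂ →(g) M₃ → 0` of *discrete* `Γ`-modules with jointly continuous actions (the
tree's `ContinuousRep` and `IsSES`, `DiscreteCochains.lean`), this file constructs the two low
connecting homomorphisms of the long exact cohomology sequence of Mathlib's continuous cohomology
**as maps**, with their explicit cocycle formulas, and proves the exactness statements around them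
in element form (Serre, *Cohomologie galoisienne*, I §2.2, "suite exacte de cohomologie" attached
to `0 → A → B → C → 0`, with the continuous cochains of I §2.2–2.3; Neukirch–Schmidt–Wingberg,
*Cohomology of Number Fields*, (1.3.2)):

* `IsSES.δ₀ : M₃^Γ →ₗ H¹(Γ, M₁)`, `v ↦ [σ ↦ f⁻¹(σ w - w)]` for any lift `w` of `v`
  (`δ₀_apply_eq`), and `IsSES.δ₁ : H¹(Γ, M₃) →ₗ H²(Γ, M₁)`,
  `[g ∘ φ̃] ↦ [(σ, τ) ↦ f⁻¹(σ φ̃(τ) - φ̃(στ) + φ̃(σ))]` for **any** continuous lift `φ̃ : Γ → M₂`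
  of a crossed homomorphism into `M₃` (`IsSES.connectingCocycle`, `δ₁_oneCocycleClass`);
* exactness at `M₃^Γ` (`δ₀_eq_zero_iff`), at `H¹(M₁)` (`map_one_δ₀`,
  `exists_δ₀_eq_of_map_one_eq_zero`), at `H¹(M₂)` (`exists_map_one_eq_of_map_one_eq_zero`), at
  `H¹(M₃)` (`δ₁_map_one`, `exists_map_one_eq_of_δ₁_eq_zero`), at `H²(M₁)` (`map_two_δ₁`,
  `exists_δ₁_eq_of_map_two_eq_zero`) and at `H²(M₂)` (`exists_map_two_eq_of_map_two_eq_zero`).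

Lifts are continuous for free: a set-theoretic section of `g : M₂ → M₃` composed with a
continuous map into the discrete `M₃` is continuous, and the inverse of `f` on `ker g` may be
extended to an arbitrary function on the discrete `M₂` (`IsSES.inv`).  The degree-`2` side uses
the inhomogeneous `2`-cocycles of `ContinuousH2.lean`; coboundaries of continuous `1`-cochains are
`2`-cocycles because the actions are jointly continuous (`ContinuousRep.twoCoboundary`).

## References

* J.-P. Serre, *Cohomologie galoisienne*, 5e éd., LNM 5 (1994) / *Galois Cohomology* (1997),
  I §2.2–2.3. [SerreGaloisCohomology1997]
* J. Neukirch, A. Schmidt, K. Wingberg, *Cohomology of Number Fields*, 2nd ed. (2008), I §3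
  (the long exact sequence and the connecting homomorphism on cochains). [NeukirchSchmidtWingberg2008]
* S. S. Shatz, *Profinite groups, arithmetic, and geometry* (1972), Ch. II §1 Prop. 3. [Shatz1972]
-/

noncomputable section

open CategoryTheory Limits Function

universe u v

namespace Literature.NumberTheory.GaloisRepresentations

open _root_.TopRep _root_.ContRepresentation _root_.ContinuousCohomology

set_option allowUnsafeReducibility true in
attribute [local reducible] CategoryTheory.Functor.mapHomologicalComplex

/-! ### Induced maps on cohomology and equivariance, for the tree's `ContinuousRep` -/

section Helpers

variable {k : Type*} [Ring k] [TopologicalSpace k]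
variable {G : Type v} [Group G] [TopologicalSpace G] [IsTopologicalGroup G]

/-- **`Hⁿ(f) : Hⁿ(G, A) → Hⁿ(G, B)`**, the map induced on continuous cohomology by a morphism of
topological representations (Mathlib's `ContinuousCohomology.map` along the identity of `G`, fed
with the tree's `resIdHom f`). [folklore] -/
abbrev cohomologyMap {A B : TopRep.{v} k G} (f : A ⟶ B) (n : ℕ) :
    continuousCohomology n A ⟶ continuousCohomology n B :=
  ContinuousCohomology.map (ContinuousMonoidHom.id G) (resIdHom f) n

/-- `H¹(f) [φ] = [f ∘ φ]` on crossed homomorphisms. [folklore] -/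
theorem cohomologyMap_oneCocycleClass {A B : TopRep.{v} k G} (f : A ⟶ B) (φ : contOneCocycles A) :
    cohomologyMap f 1 (oneCocycleClass A φ) =
      oneCocycleClass B (contOneCocycles.pullback (ContinuousMonoidHom.id G) (resIdHom f) φ) :=
  map_oneCocycleClass _ _ _ φ

omit [IsTopologicalGroup G] in
/-- `(f ∘ φ)(σ) = f (φ σ)` for the pulled-back crossed homomorphism along the identity.
[folklore] -/
@[simp] theorem pullback_id_resIdHom_apply {A B : TopRep.{v} k G} (f : A ⟶ B)
    (φ : contOneCocycles A) (σ : G) :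
    (contOneCocycles.pullback (ContinuousMonoidHom.id G) (resIdHom f) φ).1 σ = f.hom (φ.1 σ) := rfl

end Helpers

section HelpersTwo

variable {k : Type u} [CommRing k] [TopologicalSpace k]
variable {G : Type v} [Group G] [TopologicalSpace G] [IsTopologicalGroup G] [LocallyCompactSpace G]

/-- `H²(f) [c] = [f ∘ c]` on inhomogeneous `2`-cocycles. [folklore] -/
theorem cohomologyMap_twoCocycleClass {A B : TopRep.{v} k G} (f : A ⟶ B) (c : contTwoCocycles A) :
    cohomologyMap f 2 (twoCocycleClass A c) =
      twoCocycleClass B (contTwoCocycles.pullback (ContinuousMonoidHom.id G) (resIdHom f) c) :=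
  map_twoCocycleClass _ _ _ c

omit [IsTopologicalGroup G] [LocallyCompactSpace G] in
/-- `(f ∘ c)(σ, τ) = f (c(σ, τ))` for the pulled-back `2`-cocycle along the identity. [folklore] -/
@[simp] theorem pullback₂_id_resIdHom_apply {A B : TopRep.{v} k G} (f : A ⟶ B)
    (c : contTwoCocycles A) (σ τ : G) :
    (contTwoCocycles.pullback (ContinuousMonoidHom.id G) (resIdHom f) c).1 (σ, τ) =
      f.hom (c.1 (σ, τ)) := rfl

end HelpersTwo

namespace ContinuousRep

variable {A : Type*} [CommRing A] [TopologicalSpace A]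
variable {Γ : Type u} [Group Γ] [TopologicalSpace Γ]
variable {M : Type u} [AddCommGroup M] [Module A M] [TopologicalSpace M] [IsTopologicalAddGroup M]
  [ContinuousSMul A M]
variable {M' : Type u} [AddCommGroup M'] [Module A M'] [TopologicalSpace M']
  [IsTopologicalAddGroup M'] [ContinuousSMul A M']
variable {ρ : ContinuousRep Γ A M} {ρ' : ContinuousRep Γ A M'}

/-- Equivariance of a morphism of the attached topological representations, in terms of the
`ContinuousRep`s: `φ (ρ σ x) = ρ' σ (φ x)`. [folklore] -/
theorem hom_comm_apply (φ : ρ.toTopRep ⟶ ρ'.toTopRep) (σ : Γ) (x : M) :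
    φ.hom (ρ σ x) = ρ' σ (φ.hom x) :=
  TopRep.hom_comm_apply φ σ x

variable (ρ) in
/-- The action of the attached topological representation is `ρ`. [folklore] -/
@[simp] theorem toTopRep_ρ_apply (σ : Γ) (x : M) : ρ.toTopRep.ρ σ x = ρ σ x := rfl

end ContinuousRep

/-! ### Coboundaries of continuous `1`-cochains (jointly continuous actions) -/

namespace ContinuousRep

variable {A : Type*} [CommRing A] [TopologicalSpace A]
variable {Γ : Type u} [Group Γ] [TopologicalSpace Γ] [IsTopologicalGroup Γ]
variable {M : Type u} [AddCommGroup M] [Module A M] [TopologicalSpace M] [IsTopologicalAddGroup M]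
  [ContinuousSMul A M]
variable (ρ : ContinuousRep Γ A M)

/-- The **inhomogeneous coboundary** `(σ, τ) ↦ σ b(τ) - b(στ) + b(σ)` of a continuous `1`-cochain
`b : Γ → M`, a continuous `2`-cocycle (continuity by the joint continuity of the action).
Ref: Serre, *Cohomologie galoisienne*, I §2.2–2.3. [folklore] -/
def twoCoboundary (b : C(Γ, M)) : contTwoCocycles ρ.toTopRep :=
  ⟨⟨fun p => ρ p.1 (b p.2) - b (p.1 * p.2) + b p.1,
      ((ρ.continuous_apply₂.comp (continuous_fst.prodMk (b.continuous.comp continuous_snd))).sub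
        (b.continuous.comp (continuous_fst.mul continuous_snd))).add
        (b.continuous.comp continuous_fst)⟩, fun σ τ υ => by
    change ρ σ (ρ τ (b υ) - b (τ * υ) + b τ) + (ρ σ (b (τ * υ)) - b (σ * (τ * υ)) + b σ) =
      ρ (σ * τ) (b υ) - b (σ * τ * υ) + b (σ * τ) + (ρ σ (b τ) - b (σ * τ) + b σ)
    rw [_root_.map_mul ρ, Module.End.mul_apply, map_add, map_sub, mul_assoc]
    abel⟩

/-- Unfolding `twoCoboundary`. [folklore] -/
@[simp] theorem twoCoboundary_apply (b : C(Γ, M)) (σ τ : Γ) :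
    (ρ.twoCoboundary b).1 (σ, τ) = ρ σ (b τ) - b (σ * τ) + b σ := rfl

/-- A coboundary has trivial class. [folklore] -/
theorem twoCocycleClass_twoCoboundary [LocallyCompactSpace Γ] (b : C(Γ, M)) :
    twoCocycleClass ρ.toTopRep (ρ.twoCoboundary b) = 0 :=
  (twoCocycleClass_eq_zero_iff ρ.toTopRep _).2 ⟨b, fun _ _ => rfl⟩

end ContinuousRep

/-! ### The connecting homomorphisms -/

namespace IsSES

variable {A : Type*} [CommRing A] [TopologicalSpace A]
variable {Γ : Type u} [Group Γ] [TopologicalSpace Γ] [IsTopologicalGroup Γ]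
variable {M₁ : Type u} [AddCommGroup M₁] [Module A M₁] [TopologicalSpace M₁] [DiscreteTopology M₁]
  [ContinuousSMul A M₁]
variable {M₂ : Type u} [AddCommGroup M₂] [Module A M₂] [TopologicalSpace M₂] [DiscreteTopology M₂]
  [ContinuousSMul A M₂]
variable {M₃ : Type u} [AddCommGroup M₃] [Module A M₃] [TopologicalSpace M₃] [DiscreteTopology M₃]
  [ContinuousSMul A M₃]
variable {ρ₁ : ContinuousRep Γ A M₁} {ρ₂ : ContinuousRep Γ A M₂} {ρ₃ : ContinuousRep Γ A M₃}
variable {f : ρ₁.toTopRep ⟶ ρ₂.toTopRep} {g : ρ₂.toTopRep ⟶ ρ₃.toTopRep}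

/-! #### Inverting `f` on `ker g`, lifting through `g` -/

omit [IsTopologicalGroup Γ] in
/-- `g (f x) = 0`. [folklore] -/
theorem g_f_apply (h : IsSES f g) (x : M₁) : g.hom (f.hom x) = 0 :=
  congr(($(h.comp_eq_zero)).hom x)

/-- The inverse of `f` on `ker g = im f`, extended by `0` to a function on all of `M₂` (any such
extension is continuous, `M₂` being discrete). [folklore] -/
def inv (h : IsSES f g) (y : M₂) : M₁ :=
  open Classical in if hy : g.hom y = 0 then (h.exact_mid y hy).choose else 0

omit [IsTopologicalGroup Γ] in
/-- `f (f⁻¹ y) = y` on `ker g`. [folklore] -/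
theorem f_inv (h : IsSES f g) {y : M₂} (hy : g.hom y = 0) : f.hom (h.inv y) = y := by
  rw [inv, dif_pos hy]
  exact (h.exact_mid y hy).choose_spec

omit [IsTopologicalGroup Γ] in
/-- `f⁻¹ (f x) = x`. [folklore] -/
theorem inv_f (h : IsSES f g) (x : M₁) : h.inv (f.hom x) = x :=
  h.injective (h.f_inv (h.g_f_apply x))

omit [IsTopologicalGroup Γ] in
/-- `f⁻¹` is characterised on `ker g` by `f x = y`. [folklore] -/
theorem inv_eq_of_f_eq (h : IsSES f g) {y : M₂} {x : M₁} (hx : f.hom x = y) : h.inv y = x := by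
  rw [← hx, inv_f]

/-- A set-theoretic section of `g`. [folklore] -/
def lift (h : IsSES f g) (v : M₃) : M₂ := (h.surjective v).choose

omit [IsTopologicalGroup Γ] in
/-- `g (lift v) = v`. [folklore] -/
@[simp] theorem g_lift (h : IsSES f g) (v : M₃) : g.hom (h.lift v) = v :=
  (h.surjective v).choose_spec

/-! #### `δ₀ : M₃^Γ → H¹(Γ, M₁)` -/

/-- The crossed homomorphism `σ ↦ f⁻¹(σ w - w)` attached to an element `w ∈ M₂` whose image in
`M₃` is invariant: the cocycle of the connecting map `δ₀`.
Ref: Serre, *Cohomologie galoisienne*, I §2.2; Neukirch–Schmidt–Wingberg (1.3.2). [folklore] -/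
def δ₀Cocycle (h : IsSES f g) (w : M₂) (hw : g.hom w ∈ ρ₃.toTopRep.ρ.invariants) :
    contOneCocycles ρ₁.toTopRep :=
  ⟨⟨fun σ => h.inv (ρ₂ σ w - w),
      (continuous_of_discreteTopology (f := h.inv)).comp
        ((ρ₂.continuous_apply_left w).sub continuous_const)⟩, by
    have hker : ∀ σ, g.hom (ρ₂ σ w - w) = 0 := fun σ => by
      rw [map_sub, sub_eq_zero]
      exact (ContinuousRep.hom_comm_apply g σ w).trans (hw σ)
    intro σ τ
    apply h.injective
    change f.hom (h.inv (ρ₂ (σ * τ) w - w)) =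
      f.hom (h.inv (ρ₂ σ w - w) + ρ₁ σ (h.inv (ρ₂ τ w - w)))
    rw [map_add, h.f_inv (hker _), h.f_inv (hker _), ContinuousRep.hom_comm_apply f σ,
      h.f_inv (hker _), _root_.map_mul ρ₂, Module.End.mul_apply, map_sub]
    abel⟩

omit [IsTopologicalGroup Γ] in
/-- Unfolding `δ₀Cocycle`: `f (δ₀Cocycle w σ) = σ w - w`. [folklore] -/
theorem f_δ₀Cocycle_apply (h : IsSES f g) (w : M₂) (hw : g.hom w ∈ ρ₃.toTopRep.ρ.invariants)
    (σ : Γ) : f.hom ((h.δ₀Cocycle w hw).1 σ) = ρ₂ σ w - w := by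
  change f.hom (h.inv (ρ₂ σ w - w)) = _
  refine h.f_inv ?_
  rw [map_sub, sub_eq_zero]
  exact (ContinuousRep.hom_comm_apply g σ w).trans (hw σ)

/-- Two lifts of the same invariant give cohomologous cocycles: if `g w = g w'` then
`δ₀Cocycle w - δ₀Cocycle w'` is the principal crossed homomorphism of `f⁻¹(w - w')`. [folklore] -/
theorem oneCocycleClass_δ₀Cocycle_eq (h : IsSES f g) (w w' : M₂)
    (hw : g.hom w ∈ ρ₃.toTopRep.ρ.invariants) (hw' : g.hom w' ∈ ρ₃.toTopRep.ρ.invariants)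
    (e : g.hom w = g.hom w') :
    oneCocycleClass _ (h.δ₀Cocycle w hw) = oneCocycleClass _ (h.δ₀Cocycle w' hw') := by
  rw [← sub_eq_zero, ← oneCocycleClass_sub, oneCocycleClass_eq_zero_iff]
  have hd : g.hom (w - w') = 0 := by rw [map_sub, e, sub_self]
  refine ⟨h.inv (w - w'), fun σ => h.injective ?_⟩
  change f.hom ((h.δ₀Cocycle w hw).1 σ - (h.δ₀Cocycle w' hw').1 σ) =
    f.hom (ρ₁ σ (h.inv (w - w')) - h.inv (w - w'))
  rw [map_sub, map_sub, f_δ₀Cocycle_apply, f_δ₀Cocycle_apply, ContinuousRep.hom_comm_apply f σ,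
    h.f_inv hd, map_sub]
  abel

/-- **The connecting homomorphism `δ₀ : M₃^Γ → H¹(Γ, M₁)`**, `v ↦ [σ ↦ f⁻¹(σ w - w)]` for a lift
`w` of `v` (independent of the lift, `δ₀_apply_eq`).
Ref: Serre, *Cohomologie galoisienne*, I §2.2 (suite exacte de cohomologie);
Neukirch–Schmidt–Wingberg (2008), (1.3.2). [cite: SerreGaloisCohomology1997, I §2.2] -/
def δ₀ (h : IsSES f g) : ρ₃.toTopRep.ρ.invariants →ₗ[A] continuousCohomology 1 ρ₁.toTopRep where
  toFun v := oneCocycleClass _ (h.δ₀Cocycle (h.lift v.1) (by rw [h.g_lift]; exact v.2))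
  map_add' v v' := by
    have hvv : g.hom (h.lift v.1 + h.lift v'.1) ∈ ρ₃.toTopRep.ρ.invariants := by
      rw [map_add, g_lift, g_lift]; exact (v + v').2
    rw [h.oneCocycleClass_δ₀Cocycle_eq (h.lift (v + v').1) (h.lift v.1 + h.lift v'.1) _ hvv
      (by rw [g_lift, map_add, g_lift, g_lift]; rfl), ← oneCocycleClass_add]
    refine congrArg _ (Subtype.ext (ContinuousMap.ext fun σ => h.injective ?_))
    change f.hom ((h.δ₀Cocycle _ hvv).1 σ) =
      f.hom ((h.δ₀Cocycle (h.lift v.1) _).1 σ + (h.δ₀Cocycle (h.lift v'.1) _).1 σ)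
    rw [map_add, f_δ₀Cocycle_apply, f_δ₀Cocycle_apply, f_δ₀Cocycle_apply, map_add]
    abel
  map_smul' a v := by
    have hav : g.hom (a • h.lift v.1) ∈ ρ₃.toTopRep.ρ.invariants := by
      rw [map_smul, g_lift]; exact (a • v).2
    rw [h.oneCocycleClass_δ₀Cocycle_eq (h.lift (a • v).1) (a • h.lift v.1) _ hav
      (by rw [g_lift, map_smul, g_lift]; rfl), RingHom.id_apply, ← oneCocycleClass_smul]
    refine congrArg _ (Subtype.ext (ContinuousMap.ext fun σ => h.injective ?_))
    change f.hom ((h.δ₀Cocycle _ hav).1 σ) = f.hom (a • (h.δ₀Cocycle (h.lift v.1) _).1 σ)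
    rw [map_smul, f_δ₀Cocycle_apply, f_δ₀Cocycle_apply, map_smul, smul_sub]

/-- **`δ₀ v` is the class of `σ ↦ f⁻¹(σ w - w)` for every lift `w` of `v`.** [folklore] -/
theorem δ₀_apply_eq (h : IsSES f g) (v : ρ₃.toTopRep.ρ.invariants) (w : M₂) (hw : g.hom w = v) :
    h.δ₀ v = oneCocycleClass _ (h.δ₀Cocycle w (by rw [hw]; exact v.2)) :=
  h.oneCocycleClass_δ₀Cocycle_eq _ _ _ _ (by rw [g_lift, hw])

/-- **Exactness at `M₃^Γ`**: `δ₀ v = 0` iff `v` lifts to an invariant of `M₂`.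
[cite: SerreGaloisCohomology1997, I §2.2] -/
theorem δ₀_eq_zero_iff (h : IsSES f g) (v : ρ₃.toTopRep.ρ.invariants) :
    h.δ₀ v = 0 ↔ ∃ w ∈ ρ₂.toTopRep.ρ.invariants, g.hom w = v := by
  constructor
  · intro hv
    change oneCocycleClass _ (h.δ₀Cocycle (h.lift v.1) _) = 0 at hv
    obtain ⟨m, hm⟩ := (oneCocycleClass_eq_zero_iff _ _).1 hv
    refine ⟨h.lift v.1 - f.hom m, fun σ => ?_, by rw [map_sub, g_lift, h.g_f_apply, sub_zero]⟩
    have hσ := congrArg f.hom (hm σ)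
    rw [f_δ₀Cocycle_apply, map_sub] at hσ
    change ρ₂ σ (h.lift v.1) - h.lift v.1 = f.hom (ρ₁ σ m) - f.hom m at hσ
    rw [ContinuousRep.hom_comm_apply f σ] at hσ
    change ρ₂ σ (h.lift v.1 - f.hom m) = h.lift v.1 - f.hom m
    rw [map_sub, sub_eq_sub_iff_sub_eq_sub, hσ]
  · rintro ⟨w, hw, hwv⟩
    rw [h.δ₀_apply_eq v w hwv, oneCocycleClass_eq_zero_iff]
    refine ⟨0, fun σ => h.injective ?_⟩
    rw [f_δ₀Cocycle_apply, map_zero, sub_zero, map_zero]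
    exact sub_eq_zero.2 (hw σ)

/-- **`H¹(f) ∘ δ₀ = 0`**: the image in `M₂` of the cocycle `σ ↦ f⁻¹(σ w - w)` is principal.
[cite: SerreGaloisCohomology1997, I §2.2] -/
theorem map_one_δ₀ (h : IsSES f g) (v : ρ₃.toTopRep.ρ.invariants) :
    cohomologyMap f 1 (h.δ₀ v) = 0 := by
  have hv : g.hom (h.lift v.1) ∈ ρ₃.toTopRep.ρ.invariants := by rw [h.g_lift]; exact v.2
  change cohomologyMap f 1 (oneCocycleClass _ (h.δ₀Cocycle (h.lift v.1) hv)) = 0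
  rw [cohomologyMap_oneCocycleClass, oneCocycleClass_eq_zero_iff]
  exact ⟨h.lift v.1, fun σ => h.f_δ₀Cocycle_apply (h.lift v.1) hv σ⟩

/-- **Exactness at `H¹(Γ, M₁)`**: a class killed by `H¹(f)` is in the image of `δ₀`.
[cite: SerreGaloisCohomology1997, I §2.2] -/
theorem exists_δ₀_eq_of_map_one_eq_zero (h : IsSES f g) (x : continuousCohomology 1 ρ₁.toTopRep)
    (hx : cohomologyMap f 1 x = 0) : ∃ v, h.δ₀ v = x := by
  obtain ⟨φ, rfl⟩ := oneCocycleClass_surjective _ x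
  rw [cohomologyMap_oneCocycleClass, oneCocycleClass_eq_zero_iff] at hx
  obtain ⟨w, hw⟩ := hx
  have hw' : ∀ σ, f.hom (φ.1 σ) = ρ₂ σ w - w := fun σ => hw σ
  have hgw : g.hom w ∈ ρ₃.toTopRep.ρ.invariants := fun σ => by
    change ρ₃ σ (g.hom w) = g.hom w
    rw [← sub_eq_zero, ← ContinuousRep.hom_comm_apply g σ w, ← map_sub, ← hw', h.g_f_apply]
  refine ⟨⟨g.hom w, hgw⟩, ?_⟩
  rw [h.δ₀_apply_eq _ w rfl]
  refine congrArg _ (Subtype.ext (ContinuousMap.ext fun σ => h.injective ?_))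
  rw [f_δ₀Cocycle_apply, hw']

/-- **Exactness at `H¹(Γ, M₂)`**: a class killed by `H¹(g)` comes from `H¹(Γ, M₁)`.
[cite: SerreGaloisCohomology1997, I §2.2] -/
theorem exists_map_one_eq_of_map_one_eq_zero (h : IsSES f g)
    (y : continuousCohomology 1 ρ₂.toTopRep) (hy : cohomologyMap g 1 y = 0) :
    ∃ x, cohomologyMap f 1 x = y := by
  obtain ⟨ψ, rfl⟩ := oneCocycleClass_surjective _ y
  rw [cohomologyMap_oneCocycleClass, oneCocycleClass_eq_zero_iff] at hy
  obtain ⟨v, hv⟩ := hy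
  have hv' : ∀ σ, g.hom (ψ.1 σ) = ρ₃ σ v - v := fun σ => hv σ
  -- correct `ψ` by the principal cocycle of a lift of `v`
  let w := h.lift v
  have hker : ∀ σ, g.hom (ψ.1 σ - (ρ₂ σ w - w)) = 0 := fun σ => by
    rw [map_sub, map_sub, hv', ContinuousRep.hom_comm_apply g σ w]
    change ρ₃ σ v - v - (ρ₃ σ (g.hom (h.lift v)) - g.hom (h.lift v)) = 0
    rw [g_lift, sub_self]
  let φ : contOneCocycles ρ₁.toTopRep :=
    ⟨⟨fun σ => h.inv (ψ.1 σ - (ρ₂ σ w - w)),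
        (continuous_of_discreteTopology (f := h.inv)).comp
          (ψ.1.continuous.sub ((ρ₂.continuous_apply_left w).sub continuous_const))⟩, by
      intro σ τ
      apply h.injective
      change f.hom (h.inv (ψ.1 (σ * τ) - (ρ₂ (σ * τ) w - w))) =
        f.hom (h.inv (ψ.1 σ - (ρ₂ σ w - w)) + ρ₁ σ (h.inv (ψ.1 τ - (ρ₂ τ w - w))))
      rw [map_add, h.f_inv (hker _), h.f_inv (hker _), ContinuousRep.hom_comm_apply f σ,
        h.f_inv (hker _), ψ.2 σ τ, _root_.map_mul ρ₂, Module.End.mul_apply, map_sub, map_sub]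
      change ψ.1 σ + ρ₂ σ (ψ.1 τ) - _ = _
      abel⟩
  refine ⟨oneCocycleClass _ φ, ?_⟩
  rw [cohomologyMap_oneCocycleClass, eq_comm, ← sub_eq_zero, ← oneCocycleClass_sub,
    oneCocycleClass_eq_zero_iff]
  refine ⟨w, fun σ => ?_⟩
  change ψ.1 σ - f.hom (h.inv (ψ.1 σ - (ρ₂ σ w - w))) = ρ₂ σ w - w
  rw [h.f_inv (hker σ), sub_sub_cancel]

/-! #### `δ₁ : H¹(Γ, M₃) → H²(Γ, M₁)` -/

/-- **The connecting cocycle** `(σ, τ) ↦ f⁻¹(σ φ̃(τ) - φ̃(στ) + φ̃(σ))` attached to a continuous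
map `φ̃ : Γ → M₂` lifting a crossed homomorphism into `M₃` (i.e. `g ∘ φ̃` is a crossed
homomorphism): a continuous `2`-cocycle with values in `M₁`.
Ref: Serre, *Cohomologie galoisienne*, I §2.2–2.3; Neukirch–Schmidt–Wingberg (1.3.2). [folklore] -/
def connectingCocycle (h : IsSES f g) (φt : C(Γ, M₂))
    (hφ : ∀ σ τ, g.hom (φt (σ * τ)) = g.hom (φt σ) + ρ₃ σ (g.hom (φt τ))) :
    contTwoCocycles ρ₁.toTopRep :=
  ⟨⟨fun p => h.inv ((ρ₂.twoCoboundary φt).1 p),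
      (continuous_of_discreteTopology (f := h.inv)).comp (ρ₂.twoCoboundary φt).1.continuous⟩, by
    have hker : ∀ σ τ, g.hom ((ρ₂.twoCoboundary φt).1 (σ, τ)) = 0 := fun σ τ => by
      rw [ContinuousRep.twoCoboundary_apply, map_add, map_sub, hφ, ContinuousRep.hom_comm_apply g σ]
      abel
    intro σ τ υ
    apply h.injective
    change f.hom (ρ₁ σ (h.inv ((ρ₂.twoCoboundary φt).1 (τ, υ))) +
        h.inv ((ρ₂.twoCoboundary φt).1 (σ, τ * υ))) =
      f.hom (h.inv ((ρ₂.twoCoboundary φt).1 (σ * τ, υ)) + h.inv ((ρ₂.twoCoboundary φt).1 (σ, τ)))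
    rw [map_add, map_add, h.f_inv (hker _ _), h.f_inv (hker _ _), h.f_inv (hker _ _),
      ContinuousRep.hom_comm_apply f σ, h.f_inv (hker _ _)]
    exact (ρ₂.twoCoboundary φt).2 σ τ υ⟩

/-- Unfolding `connectingCocycle`: `f (c(σ, τ)) = σ φ̃(τ) - φ̃(στ) + φ̃(σ)`. [folklore] -/
theorem f_connectingCocycle_apply (h : IsSES f g) (φt : C(Γ, M₂))
    (hφ : ∀ σ τ, g.hom (φt (σ * τ)) = g.hom (φt σ) + ρ₃ σ (g.hom (φt τ))) (σ τ : Γ) :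
    f.hom ((h.connectingCocycle φt hφ).1 (σ, τ)) = ρ₂ σ (φt τ) - φt (σ * τ) + φt σ := by
  change f.hom (h.inv ((ρ₂.twoCoboundary φt).1 (σ, τ))) = _
  refine h.f_inv ?_
  rw [ContinuousRep.twoCoboundary_apply, map_add, map_sub, hφ, ContinuousRep.hom_comm_apply g σ]
  abel

/-- The crossed homomorphism `g ∘ φ̃` into `M₃` of a lift `φ̃`. [folklore] -/
def pushCocycle (φt : C(Γ, M₂))
    (hφ : ∀ σ τ, g.hom (φt (σ * τ)) = g.hom (φt σ) + ρ₃ σ (g.hom (φt τ))) :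
    contOneCocycles ρ₃.toTopRep :=
  ⟨(g.hom : C(M₂, M₃)).comp φt, hφ⟩

omit [IsTopologicalGroup Γ] in
/-- Unfolding `pushCocycle`. [folklore] -/
@[simp] theorem pushCocycle_apply (φt : C(Γ, M₂))
    (hφ : ∀ σ τ, g.hom (φt (σ * τ)) = g.hom (φt σ) + ρ₃ σ (g.hom (φt τ))) (σ : Γ) :
    (pushCocycle φt hφ : contOneCocycles ρ₃.toTopRep).1 σ = g.hom (φt σ) := rfl

/-- The canonical continuous lift `lift ∘ φ` of a crossed homomorphism `φ : Γ → M₃`.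
[folklore] -/
def liftCocycle (h : IsSES f g) (φ : contOneCocycles ρ₃.toTopRep) : C(Γ, M₂) :=
  ⟨h.lift ∘ φ.1, (continuous_of_discreteTopology (f := h.lift)).comp φ.1.continuous⟩

omit [IsTopologicalGroup Γ] in
/-- `g (liftCocycle φ σ) = φ σ`. [folklore] -/
@[simp] theorem g_liftCocycle_apply (h : IsSES f g) (φ : contOneCocycles ρ₃.toTopRep) (σ : Γ) :
    g.hom (h.liftCocycle φ σ) = φ.1 σ :=
  h.g_lift _

omit [IsTopologicalGroup Γ] in
/-- `liftCocycle φ` lifts the crossed homomorphism `φ`. [folklore] -/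
theorem liftCocycle_isLift (h : IsSES f g) (φ : contOneCocycles ρ₃.toTopRep) (σ τ : Γ) :
    g.hom (h.liftCocycle φ (σ * τ)) = g.hom (h.liftCocycle φ σ) + ρ₃ σ (g.hom (h.liftCocycle φ τ)) := by
  rw [g_liftCocycle_apply, g_liftCocycle_apply, g_liftCocycle_apply]
  exact φ.2 σ τ

omit [IsTopologicalGroup Γ] in
/-- `g ∘ liftCocycle φ = φ`. [folklore] -/
theorem pushCocycle_liftCocycle (h : IsSES f g) (φ : contOneCocycles ρ₃.toTopRep) :
    pushCocycle (h.liftCocycle φ) (h.liftCocycle_isLift φ) = φ :=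
  Subtype.ext (ContinuousMap.ext fun σ => h.g_liftCocycle_apply φ σ)

/-- **Independence of the lift, up to coboundaries**: two continuous lifts of the *same* crossed
homomorphism give connecting cocycles differing by the coboundary of `f⁻¹(φ̃ - φ̃')`. [folklore] -/
theorem twoCocycleClass_connectingCocycle_eq [LocallyCompactSpace Γ] (h : IsSES f g)
    (φt φt' : C(Γ, M₂))
    (hφ : ∀ σ τ, g.hom (φt (σ * τ)) = g.hom (φt σ) + ρ₃ σ (g.hom (φt τ)))
    (hφ' : ∀ σ τ, g.hom (φt' (σ * τ)) = g.hom (φt' σ) + ρ₃ σ (g.hom (φt' τ)))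
    (e : ∀ σ, g.hom (φt σ) = g.hom (φt' σ)) :
    twoCocycleClass _ (h.connectingCocycle φt hφ) =
      twoCocycleClass _ (h.connectingCocycle φt' hφ') := by
  rw [← sub_eq_zero, ← twoCocycleClass_sub, twoCocycleClass_eq_zero_iff]
  have hd : ∀ σ, g.hom (φt σ - φt' σ) = 0 := fun σ => by rw [map_sub, e, sub_self]
  refine ⟨⟨fun σ => h.inv (φt σ - φt' σ),
    (continuous_of_discreteTopology (f := h.inv)).comp (φt.continuous.sub φt'.continuous)⟩,
    fun σ τ => h.injective ?_⟩
  change f.hom ((h.connectingCocycle φt hφ).1 (σ, τ) - (h.connectingCocycle φt' hφ').1 (σ, τ)) =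
    f.hom (ρ₁ σ (h.inv (φt τ - φt' τ)) - h.inv (φt (σ * τ) - φt' (σ * τ)) +
      h.inv (φt σ - φt' σ))
  rw [map_sub, f_connectingCocycle_apply, f_connectingCocycle_apply, map_add, map_sub,
    ContinuousRep.hom_comm_apply f σ, h.f_inv (hd _), h.f_inv (hd _), h.f_inv (hd _), map_sub]
  abel

/-- **Independence of the representative**: lifts of cohomologous crossed homomorphisms have
cohomologous connecting cocycles. [folklore] -/
theorem twoCocycleClass_connectingCocycle_eq_of_oneCocycleClass_eq [LocallyCompactSpace Γ]
    (h : IsSES f g) (φt φt' : C(Γ, M₂))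
    (hφ : ∀ σ τ, g.hom (φt (σ * τ)) = g.hom (φt σ) + ρ₃ σ (g.hom (φt τ)))
    (hφ' : ∀ σ τ, g.hom (φt' (σ * τ)) = g.hom (φt' σ) + ρ₃ σ (g.hom (φt' τ)))
    (e : oneCocycleClass _ (pushCocycle φt hφ) = oneCocycleClass _ (pushCocycle φt' hφ')) :
    twoCocycleClass _ (h.connectingCocycle φt hφ) =
      twoCocycleClass _ (h.connectingCocycle φt' hφ') := by
  rw [← sub_eq_zero, ← oneCocycleClass_sub, oneCocycleClass_eq_zero_iff] at e
  obtain ⟨v, hv⟩ := e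
  have hv' : ∀ σ, g.hom (φt σ) - g.hom (φt' σ) = ρ₃ σ v - v := fun σ => hv σ
  -- the lift `φ̃' + (σ w - w)` of `g ∘ φ̃`, `w` a lift of `v`, has the same coboundary as `φ̃'`
  let w := h.lift v
  let ψ : C(Γ, M₂) := φt' + ⟨fun σ => ρ₂ σ w - w, (ρ₂.continuous_apply_left w).sub continuous_const⟩
  have hψv : ∀ σ, ψ σ = φt' σ + (ρ₂ σ w - w) := fun _ => rfl
  have hψg : ∀ σ, g.hom (φt σ) = g.hom (ψ σ) := fun σ => by
    rw [hψv, map_add, map_sub, ContinuousRep.hom_comm_apply g σ w]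
    change _ = _ + (ρ₃ σ (g.hom (h.lift v)) - g.hom (h.lift v))
    rw [g_lift, ← hv', add_sub_cancel]
  have hψ : ∀ σ τ, g.hom (ψ (σ * τ)) = g.hom (ψ σ) + ρ₃ σ (g.hom (ψ τ)) := fun σ τ => by
    rw [← hψg, ← hψg, ← hψg]; exact hφ σ τ
  rw [h.twoCocycleClass_connectingCocycle_eq φt ψ hφ hψ hψg]
  refine congrArg _ (Subtype.ext (ContinuousMap.ext fun p => ?_))
  obtain ⟨σ, τ⟩ := p
  apply h.injective
  rw [f_connectingCocycle_apply, f_connectingCocycle_apply, hψv, hψv, hψv, map_add, map_sub,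
    _root_.map_mul ρ₂, Module.End.mul_apply]
  abel

/-- Additivity of the connecting cocycle in the lift. [folklore] -/
theorem connectingCocycle_add (h : IsSES f g) (φt φt' : C(Γ, M₂))
    (hφ : ∀ σ τ, g.hom (φt (σ * τ)) = g.hom (φt σ) + ρ₃ σ (g.hom (φt τ)))
    (hφ' : ∀ σ τ, g.hom (φt' (σ * τ)) = g.hom (φt' σ) + ρ₃ σ (g.hom (φt' τ)))
    (hadd : ∀ σ τ, g.hom ((φt + φt') (σ * τ)) =
      g.hom ((φt + φt') σ) + ρ₃ σ (g.hom ((φt + φt') τ))) :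
    h.connectingCocycle (φt + φt') hadd =
      h.connectingCocycle φt hφ + h.connectingCocycle φt' hφ' := by
  refine Subtype.ext (ContinuousMap.ext fun p => ?_)
  obtain ⟨σ, τ⟩ := p
  apply h.injective
  change f.hom ((h.connectingCocycle (φt + φt') hadd).1 (σ, τ)) =
    f.hom ((h.connectingCocycle φt hφ).1 (σ, τ) + (h.connectingCocycle φt' hφ').1 (σ, τ))
  rw [map_add, f_connectingCocycle_apply, f_connectingCocycle_apply, f_connectingCocycle_apply]
  simp only [ContinuousMap.add_apply, map_add]
  abel

/-- Homogeneity of the connecting cocycle in the lift. [folklore] -/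
theorem connectingCocycle_smul (h : IsSES f g) (a : A) (φt : C(Γ, M₂))
    (hφ : ∀ σ τ, g.hom (φt (σ * τ)) = g.hom (φt σ) + ρ₃ σ (g.hom (φt τ)))
    (hsmul : ∀ σ τ, g.hom ((a • φt) (σ * τ)) =
      g.hom ((a • φt) σ) + ρ₃ σ (g.hom ((a • φt) τ))) :
    h.connectingCocycle (a • φt) hsmul = a • h.connectingCocycle φt hφ := by
  refine Subtype.ext (ContinuousMap.ext fun p => ?_)
  obtain ⟨σ, τ⟩ := p
  apply h.injective
  change f.hom ((h.connectingCocycle (a • φt) hsmul).1 (σ, τ)) =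
    f.hom (a • (h.connectingCocycle φt hφ).1 (σ, τ))
  rw [map_smul, f_connectingCocycle_apply, f_connectingCocycle_apply]
  simp only [ContinuousMap.smul_apply, map_smul, smul_sub, smul_add]

variable [LocallyCompactSpace Γ]

/-- The connecting class of the canonical lift of a crossed homomorphism `φ : Γ → M₃` (the value
of `δ₁` on `[φ]`, before descending to classes). [folklore] -/
def δ₁Aux (h : IsSES f g) (φ : contOneCocycles ρ₃.toTopRep) : continuousCohomology 2 ρ₁.toTopRep :=
  twoCocycleClass _ (h.connectingCocycle (h.liftCocycle φ) (h.liftCocycle_isLift φ))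

/-- `δ₁Aux` is computed by any continuous lift. [folklore] -/
theorem δ₁Aux_eq (h : IsSES f g) (φt : C(Γ, M₂))
    (hφ : ∀ σ τ, g.hom (φt (σ * τ)) = g.hom (φt σ) + ρ₃ σ (g.hom (φt τ))) :
    h.δ₁Aux (pushCocycle φt hφ) = twoCocycleClass _ (h.connectingCocycle φt hφ) :=
  h.twoCocycleClass_connectingCocycle_eq_of_oneCocycleClass_eq _ _ _ _
    (by rw [pushCocycle_liftCocycle])

/-- `δ₁Aux` depends only on the class of `φ`. [folklore] -/
theorem δ₁Aux_congr (h : IsSES f g) {φ φ' : contOneCocycles ρ₃.toTopRep}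
    (e : oneCocycleClass _ φ = oneCocycleClass _ φ') : h.δ₁Aux φ = h.δ₁Aux φ' :=
  h.twoCocycleClass_connectingCocycle_eq_of_oneCocycleClass_eq _ _ _ _
    (by rw [pushCocycle_liftCocycle, pushCocycle_liftCocycle, e])

/-- Additivity of `δ₁Aux`. [folklore] -/
theorem δ₁Aux_add (h : IsSES f g) (φ φ' : contOneCocycles ρ₃.toTopRep) :
    h.δ₁Aux (φ + φ') = h.δ₁Aux φ + h.δ₁Aux φ' := by
  have hadd : ∀ σ τ, g.hom ((h.liftCocycle φ + h.liftCocycle φ') (σ * τ)) =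
      g.hom ((h.liftCocycle φ + h.liftCocycle φ') σ) +
        ρ₃ σ (g.hom ((h.liftCocycle φ + h.liftCocycle φ') τ)) := fun σ τ => by
    simp only [ContinuousMap.add_apply, map_add]
    rw [g_liftCocycle_apply, g_liftCocycle_apply, g_liftCocycle_apply, g_liftCocycle_apply,
      g_liftCocycle_apply, g_liftCocycle_apply, φ.2 σ τ, φ'.2 σ τ]
    simp only [ContinuousRep.toContRepresentation_apply_apply]
    abel
  have e : pushCocycle (h.liftCocycle φ + h.liftCocycle φ') hadd = φ + φ' :=
    Subtype.ext (ContinuousMap.ext fun σ => by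
      change g.hom (h.liftCocycle φ σ + h.liftCocycle φ' σ) = φ.1 σ + φ'.1 σ
      rw [map_add, g_liftCocycle_apply, g_liftCocycle_apply])
  calc h.δ₁Aux (φ + φ')
      = h.δ₁Aux (pushCocycle (h.liftCocycle φ + h.liftCocycle φ') hadd) := by rw [e]
    _ = twoCocycleClass _ (h.connectingCocycle _ hadd) := h.δ₁Aux_eq _ hadd
    _ = twoCocycleClass _ (h.connectingCocycle _ (h.liftCocycle_isLift φ) +
          h.connectingCocycle _ (h.liftCocycle_isLift φ')) := by
        rw [h.connectingCocycle_add _ _ (h.liftCocycle_isLift φ) (h.liftCocycle_isLift φ') hadd]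
    _ = h.δ₁Aux φ + h.δ₁Aux φ' := by rw [twoCocycleClass_add]; rfl

/-- Homogeneity of `δ₁Aux`. [folklore] -/
theorem δ₁Aux_smul (h : IsSES f g) (a : A) (φ : contOneCocycles ρ₃.toTopRep) :
    h.δ₁Aux (a • φ) = a • h.δ₁Aux φ := by
  have hsmul : ∀ σ τ, g.hom ((a • h.liftCocycle φ) (σ * τ)) =
      g.hom ((a • h.liftCocycle φ) σ) + ρ₃ σ (g.hom ((a • h.liftCocycle φ) τ)) := fun σ τ => by
    simp only [ContinuousMap.smul_apply, map_smul]
    rw [g_liftCocycle_apply, g_liftCocycle_apply, g_liftCocycle_apply, φ.2 σ τ, smul_add]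
    simp only [ContinuousRep.toContRepresentation_apply_apply]
  have e : pushCocycle (a • h.liftCocycle φ) hsmul = a • φ :=
    Subtype.ext (ContinuousMap.ext fun σ => by
      change g.hom (a • h.liftCocycle φ σ) = a • φ.1 σ
      rw [map_smul, g_liftCocycle_apply])
  calc h.δ₁Aux (a • φ)
      = h.δ₁Aux (pushCocycle (a • h.liftCocycle φ) hsmul) := by rw [e]
    _ = twoCocycleClass _ (h.connectingCocycle _ hsmul) := h.δ₁Aux_eq _ hsmul
    _ = twoCocycleClass _ (a • h.connectingCocycle _ (h.liftCocycle_isLift φ)) := by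
        rw [h.connectingCocycle_smul a _ (h.liftCocycle_isLift φ) hsmul]
    _ = a • h.δ₁Aux φ := by rw [twoCocycleClass_smul]; rfl

/-- **The connecting homomorphism `δ₁ : H¹(Γ, M₃) → H²(Γ, M₁)`** of a short exact sequence of
discrete modules, `[φ] ↦ [(σ, τ) ↦ f⁻¹(σ φ̃(τ) - φ̃(στ) + φ̃(σ))]` for a continuous lift `φ̃` of `φ`
(well defined by `twoCocycleClass_connectingCocycle_eq_of_oneCocycleClass_eq`; computed on any
lift by `δ₁_oneCocycleClass`).
Ref: Serre, *Cohomologie galoisienne*, I §2.2–2.3; Neukirch–Schmidt–Wingberg (2008), (1.3.2).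
[cite: SerreGaloisCohomology1997, I §2.2] -/
def δ₁ (h : IsSES f g) : continuousCohomology 1 ρ₃.toTopRep →ₗ[A] continuousCohomology 2 ρ₁.toTopRep where
  toFun x := h.δ₁Aux (surjInv (oneCocycleClass_surjective _) x)
  map_add' x x' := by
    obtain ⟨φ, rfl⟩ := oneCocycleClass_surjective _ x
    obtain ⟨φ', rfl⟩ := oneCocycleClass_surjective _ x'
    rw [← oneCocycleClass_add,
      h.δ₁Aux_congr (surjInv_eq (oneCocycleClass_surjective _) (oneCocycleClass _ (φ + φ'))),
      h.δ₁Aux_congr (surjInv_eq (oneCocycleClass_surjective _) (oneCocycleClass _ φ)),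
      h.δ₁Aux_congr (surjInv_eq (oneCocycleClass_surjective _) (oneCocycleClass _ φ')),
      δ₁Aux_add]
  map_smul' a x := by
    obtain ⟨φ, rfl⟩ := oneCocycleClass_surjective _ x
    rw [RingHom.id_apply, ← oneCocycleClass_smul,
      h.δ₁Aux_congr (surjInv_eq (oneCocycleClass_surjective _) (oneCocycleClass _ (a • φ))),
      h.δ₁Aux_congr (surjInv_eq (oneCocycleClass_surjective _) (oneCocycleClass _ φ)),
      δ₁Aux_smul]

/-- **`δ₁` on an explicit lift**: for every continuous `φ̃ : Γ → M₂` with `g ∘ φ̃` a crossed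
homomorphism, `δ₁ [g ∘ φ̃] = [(σ, τ) ↦ f⁻¹(σ φ̃(τ) - φ̃(στ) + φ̃(σ))]`.
[cite: SerreGaloisCohomology1997, I §2.2] -/
theorem δ₁_oneCocycleClass (h : IsSES f g) (φt : C(Γ, M₂))
    (hφ : ∀ σ τ, g.hom (φt (σ * τ)) = g.hom (φt σ) + ρ₃ σ (g.hom (φt τ))) :
    h.δ₁ (oneCocycleClass _ (pushCocycle φt hφ)) =
      twoCocycleClass _ (h.connectingCocycle φt hφ) := by
  change h.δ₁Aux (surjInv (oneCocycleClass_surjective _) _) = _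
  rw [h.δ₁Aux_congr (surjInv_eq (oneCocycleClass_surjective _) _), δ₁Aux_eq]

/-- `δ₁ [φ]` is the connecting class of the canonical lift of `φ`. [folklore] -/
theorem δ₁_oneCocycleClass_eq_δ₁Aux (h : IsSES f g) (φ : contOneCocycles ρ₃.toTopRep) :
    h.δ₁ (oneCocycleClass _ φ) = h.δ₁Aux φ := by
  change h.δ₁Aux (surjInv (oneCocycleClass_surjective _) _) = _
  rw [h.δ₁Aux_congr (surjInv_eq (oneCocycleClass_surjective _) _)]

/-- **`δ₁ ∘ H¹(g) = 0`**: a crossed homomorphism into `M₂` is its own lift, with zero coboundary.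
[cite: SerreGaloisCohomology1997, I §2.2] -/
theorem δ₁_map_one (h : IsSES f g) (y : continuousCohomology 1 ρ₂.toTopRep) :
    h.δ₁ (cohomologyMap g 1 y) = 0 := by
  obtain ⟨ψ, rfl⟩ := oneCocycleClass_surjective _ y
  have hψ : ∀ σ τ, g.hom (ψ.1 (σ * τ)) = g.hom (ψ.1 σ) + ρ₃ σ (g.hom (ψ.1 τ)) := fun σ τ => by
    rw [ψ.2 σ τ, map_add, TopRep.hom_comm_apply g σ]
    rfl
  have e : cohomologyMap g 1 (oneCocycleClass _ ψ) = oneCocycleClass _ (pushCocycle ψ.1 hψ) := by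
    rw [cohomologyMap_oneCocycleClass]; rfl
  rw [e, δ₁_oneCocycleClass, twoCocycleClass_eq_zero_iff]
  refine ⟨0, fun σ τ => h.injective ?_⟩
  rw [f_connectingCocycle_apply, ψ.2 σ τ]
  change ρ₂ σ (ψ.1 τ) - (ψ.1 σ + ρ₂ σ (ψ.1 τ)) + ψ.1 σ = f.hom (ρ₁ σ 0 - 0 + 0)
  rw [map_zero, sub_zero, add_zero, map_zero]
  abel

/-- **Exactness at `H¹(Γ, M₃)`**: a class killed by `δ₁` comes from `H¹(Γ, M₂)` (if the
connecting cocycle of a lift `φ̃` is the coboundary of `b`, then `φ̃ - f ∘ b` is a crossed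
homomorphism into `M₂` lifting `φ`). [cite: SerreGaloisCohomology1997, I §2.2] -/
theorem exists_map_one_eq_of_δ₁_eq_zero (h : IsSES f g) (x : continuousCohomology 1 ρ₃.toTopRep)
    (hx : h.δ₁ x = 0) : ∃ y, cohomologyMap g 1 y = x := by
  obtain ⟨φ, rfl⟩ := oneCocycleClass_surjective _ x
  rw [δ₁_oneCocycleClass_eq_δ₁Aux, δ₁Aux, twoCocycleClass_eq_zero_iff] at hx
  obtain ⟨b, hb⟩ := hx
  have hb' : ∀ σ τ, ρ₂ σ (h.liftCocycle φ τ) - h.liftCocycle φ (σ * τ) + h.liftCocycle φ σ =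
      ρ₂ σ (f.hom (b τ)) - f.hom (b (σ * τ)) + f.hom (b σ) := fun σ τ => by
    rw [← f_connectingCocycle_apply h _ (h.liftCocycle_isLift φ), hb σ τ, map_add, map_sub,
      TopRep.hom_comm_apply f σ]
    rfl
  let ψ : contOneCocycles ρ₂.toTopRep :=
    ⟨h.liftCocycle φ - (f.hom : C(M₁, M₂)).comp b, fun σ τ => by
      change h.liftCocycle φ (σ * τ) - f.hom (b (σ * τ)) =
        h.liftCocycle φ σ - f.hom (b σ) + ρ₂ σ (h.liftCocycle φ τ - f.hom (b τ))
      have e := hb' σ τ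
      rw [map_sub]
      rw [← sub_eq_zero] at e ⊢
      rw [← neg_eq_zero, ← e]
      abel⟩
  refine ⟨oneCocycleClass _ ψ, ?_⟩
  rw [cohomologyMap_oneCocycleClass]
  refine congrArg _ (Subtype.ext (ContinuousMap.ext fun σ => ?_))
  rw [pullback_id_resIdHom_apply]
  change g.hom (h.liftCocycle φ σ - f.hom (b σ)) = φ.1 σ
  rw [map_sub, h.g_f_apply, sub_zero, g_liftCocycle_apply]

/-- **`H²(f) ∘ δ₁ = 0`**: `f ∘ c` is the coboundary of the lift `φ̃`.
[cite: SerreGaloisCohomology1997, I §2.2] -/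
theorem map_two_δ₁ (h : IsSES f g) (x : continuousCohomology 1 ρ₃.toTopRep) :
    cohomologyMap f 2 (h.δ₁ x) = 0 := by
  obtain ⟨φ, rfl⟩ := oneCocycleClass_surjective _ x
  rw [δ₁_oneCocycleClass_eq_δ₁Aux, δ₁Aux, cohomologyMap_twoCocycleClass,
    twoCocycleClass_eq_zero_iff]
  exact ⟨h.liftCocycle φ, fun σ τ =>
    h.f_connectingCocycle_apply (h.liftCocycle φ) (h.liftCocycle_isLift φ) σ τ⟩

/-- **Exactness at `H²(Γ, M₁)`**: a class of `H²(Γ, M₁)` killed by `H²(f)` is a value of `δ₁`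
(if `f ∘ c = d b̃` then `g ∘ b̃` is a crossed homomorphism and `c` is the connecting cocycle of the
lift `b̃`). [cite: SerreGaloisCohomology1997, I §2.2] -/
theorem exists_δ₁_eq_of_map_two_eq_zero (h : IsSES f g) (z : continuousCohomology 2 ρ₁.toTopRep)
    (hz : cohomologyMap f 2 z = 0) : ∃ x, h.δ₁ x = z := by
  obtain ⟨c, rfl⟩ := twoCocycleClass_surjective _ z
  rw [cohomologyMap_twoCocycleClass, twoCocycleClass_eq_zero_iff] at hz
  obtain ⟨bt, hbt⟩ := hz
  have hbt' : ∀ σ τ, f.hom (c.1 (σ, τ)) = ρ₂ σ (bt τ) - bt (σ * τ) + bt σ := fun σ τ => hbt σ τ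
  have hg : ∀ σ τ, g.hom (bt (σ * τ)) = g.hom (bt σ) + ρ₃ σ (g.hom (bt τ)) := fun σ τ => by
    have e := congrArg g.hom (hbt' σ τ)
    rw [h.g_f_apply, map_add, map_sub, ContinuousRep.hom_comm_apply g σ] at e
    rw [← sub_eq_zero, ← neg_eq_zero, e]
    abel
  refine ⟨oneCocycleClass _ (pushCocycle bt hg), ?_⟩
  rw [δ₁_oneCocycleClass]
  refine congrArg _ (Subtype.ext (ContinuousMap.ext fun p => ?_))
  obtain ⟨σ, τ⟩ := p
  exact h.injective ((h.f_connectingCocycle_apply bt hg σ τ).trans (hbt' σ τ).symm)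

/-- **Exactness at `H²(Γ, M₂)`**: a class of `H²(Γ, M₂)` killed by `H²(g)` comes from
`H²(Γ, M₁)` (if `g ∘ c = d β`, lift `β` to `β̃`; then `c - d β̃` takes values in `ker g = im f`).
[cite: SerreGaloisCohomology1997, I §2.2] -/
theorem exists_map_two_eq_of_map_two_eq_zero (h : IsSES f g)
    (w : continuousCohomology 2 ρ₂.toTopRep) (hw : cohomologyMap g 2 w = 0) :
    ∃ z, cohomologyMap f 2 z = w := by
  obtain ⟨c, rfl⟩ := twoCocycleClass_surjective _ w
  rw [cohomologyMap_twoCocycleClass, twoCocycleClass_eq_zero_iff] at hw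
  obtain ⟨β, hβ⟩ := hw
  have hβ' : ∀ σ τ, g.hom (c.1 (σ, τ)) = ρ₃ σ (β τ) - β (σ * τ) + β σ := fun σ τ => hβ σ τ
  let βt : C(Γ, M₂) := ⟨h.lift ∘ β, (continuous_of_discreteTopology (f := h.lift)).comp β.continuous⟩
  have hβt : ∀ σ, g.hom (βt σ) = β σ := fun σ => h.g_lift _
  -- `c - d β̃` takes values in `ker g`
  let c' : contTwoCocycles ρ₂.toTopRep := c - ρ₂.twoCoboundary βt
  have hc' : ∀ σ τ, g.hom (c'.1 (σ, τ)) = 0 := fun σ τ => by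
    change g.hom (c.1 (σ, τ) - (ρ₂.twoCoboundary βt).1 (σ, τ)) = 0
    rw [map_sub, hβ', ContinuousRep.twoCoboundary_apply, map_add, map_sub,
      ContinuousRep.hom_comm_apply g σ, hβt, hβt, hβt, sub_self]
  let c₁ : contTwoCocycles ρ₁.toTopRep :=
    ⟨⟨fun p => h.inv (c'.1 p), (continuous_of_discreteTopology (f := h.inv)).comp c'.1.continuous⟩,
      fun σ τ υ => by
        apply h.injective
        change f.hom (ρ₁ σ (h.inv (c'.1 (τ, υ))) + h.inv (c'.1 (σ, τ * υ))) =
          f.hom (h.inv (c'.1 (σ * τ, υ)) + h.inv (c'.1 (σ, τ)))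
        rw [map_add, map_add, h.f_inv (hc' _ _), h.f_inv (hc' _ _), h.f_inv (hc' _ _),
          ContinuousRep.hom_comm_apply f σ, h.f_inv (hc' _ _)]
        exact c'.2 σ τ υ⟩
  refine ⟨twoCocycleClass _ c₁, ?_⟩
  have e : contTwoCocycles.pullback (ContinuousMonoidHom.id Γ) (resIdHom f) c₁ = c' :=
    Subtype.ext (ContinuousMap.ext fun p => by
      obtain ⟨σ, τ⟩ := p
      exact h.f_inv (hc' σ τ))
  rw [cohomologyMap_twoCocycleClass, e, twoCocycleClass_sub, ρ₂.twoCocycleClass_twoCoboundary,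
    sub_zero]

end IsSES

end Literature.NumberTheory.GaloisRepresentations

end
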